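import Summits.BirchSwinnertonDyer.BirchSwinnertonDyer.Theorems.EisensteinPrimesFiniteIndexSnake
import HarnessLib

/-!
# Finite-index (Herbrand-quotient) calculus, II: the six-term rule for multiplication by `p`, and the index of the
# middle map of a morphism of three-term exact sequences (cell `bsd-eis`, seat `bsd-line-x1-p1` LEAD g4; crux 2
# `GoodLatticeBDPValue`, line `halves`, V21 index road §2 steps (1) and (3))

HONEST FRAMING (cell `bsd-eis`, run/shared/lean/pub/bsd-eis/): pure homological algebra of abelian groups (no definition,
no named fact, no `sorry`, no `Theses` import); nothing about any curve is asserted; BSD and the main conjectures are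
proved for NO curve. Helper `--supports stmt-BirchSwinnertonDyer-19032`; closes no registered stub.

## What

* §1 (road step (1), "`λ = ind ℓ − d(U/p)`"): for a short exact sequence `0 → S →ι U →π P → 0` and a prime `p`, with
  `ℓ := π|[p] : U[p] → P[p]`: `#ker ℓ = #S[p]` (`natCard_ker_torsionByMap_eq`), and, when `P` is `p`-divisible
  (`P/pP = 0`), `#(S/pS) = #coker ℓ · #(U/pU)` (`natCard_modN_eq_coker_mul`). Hence `corank S = ind ℓ − d(U/pU)` for the
  STRICT Selmer group `S = ker(U(A) ↠ P(A))` of a `p`-primary module over `K_∞` with `P(A) = ⊕_{w∣v̄} H¹(K_{∞,w}, A)` divisible.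
* §2 (road step (3)): for a morphism `(ρ_ω, ρ_f, ρ_1)` from an exact `X_ω →a X_f →b X_1` to an exact `Y_ω →a' Y_f →b' Y_1 → 0`,
  all three with finite kernel and cokernel, `a, a'` with finite kernels and `b` with finite cokernel:
  **`#ker ρ_f · #coker ρ_ω · #coker ρ_1 · #ker a · #coker b = #ker ρ_ω · #ker ρ_1 · #coker ρ_f · #ker a'`**
  (`natCard_index_three`), i.e. `ind ρ_f = ind ρ_ω + ind ρ_1 − d ker a + d ker a' − d coker b` — the residual long exact
  sequences `H¹(N_ω) → H¹(N_f) → H¹(N_1)` over `⊕_w H¹(K_{∞,w}, ·)` of the road. Proof: the six-term count (file I) for the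
  short exact rows `0 → X_ω/ker a → X_f → im b → 0`, `0 → Y_ω/ker a' → Y_f → Y_1 → 0`, then the quotient rule for
  `X_ω ↠ X_ω/ker a` and the restriction rule for `im b ≤ X_1`.

References: [MilneADT2006] I §2 (Herbrand quotients); [KellerYin2024] §1.4 (arXiv:2402.12781v2), the consumer; tree
`ZpCorankQuasiIso` / `SelmerCorankProofs` (`torsionByMap`, `modNMap`, `ker_torsionByMap_eq_range`, `ker_modNMap_eq_range`).
-/

set_option autoImplicit false
set_option linter.dupNamespace false -- the summit namespace `…BirchSwinnertonDyer.BirchSwinnertonDyer.Theorems` (Sub = Summit, D-0017) trips it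

noncomputable section

open scoped AddSubgroup

open Function Literature.NumberTheory.EllipticCurves

namespace Summit.BirchSwinnertonDyer.BirchSwinnertonDyer.Theorems.FiniteIndexCalculus

/-! ## §1 Multiplication by `p` on a short exact sequence with divisible cokernel -/

section Torsion

variable {S U P : Type*} [AddCommGroup S] [AddCommGroup U] [AddCommGroup P] {ι : S →+ U} {π : U →+ P}
  {p : ℕ}

/-- `#ker(π|[p] : U[p] → P[p]) = #S[p]` along `0 → S →ι U →π P` (`ι` injective, exact at `U`): the kernel is
`ι(S[p])`. [folklore] -/
theorem natCard_ker_torsionByMap_eq (hι : Injective ι) (hex : Exact ι π) :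
    Nat.card (torsionByMap π p).ker = Nat.card S[(p : ℤ)] := by
  rw [ker_torsionByMap_eq_range hι (fun u hu ↦ by
      obtain ⟨s, hs⟩ := (hex u).mp hu; exact ⟨s, hs⟩) (fun s ↦ hex.apply_apply_eq_zero s)]
  exact natCard_range_of_injective _ (torsionByMap_injective hι p)

/-- **`#(S/pS) = #coker(π|[p]) · #(U/pU)`** along a short exact sequence `0 → S →ι U →π P → 0` with `P` `p`-divisible and
`S/pS` finite: the six-term sequence `… → U[p] → P[p] →δ S/pS → U/pU → P/pP = 0` (Mathlib `SnakeLemma.δ'`). With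
`natCard_ker_torsionByMap_eq`: `corank S = d S[p] − d S/pS = ind(π|[p]) − d(U/pU)`. [folklore] -/
theorem natCard_modN_eq_coker_mul [Fact p.Prime] (hι : Injective ι) (hπ : Surjective π) (hex : Exact ι π)
    (hdiv : ∀ y : P, ∃ y' : P, p • y' = y) [Finite (ModN S p)] :
    Nat.card (ModN S p) = Nat.card (P[(p : ℤ)] ⧸ (torsionByMap π p).range) * Nat.card (ModN U p) := by
  -- rows and verticals, `ℤ`-linearly
  let iₗ : S →ₗ[ℤ] U := ι.toIntLinearMap
  let fₗ : U →ₗ[ℤ] P := π.toIntLinearMap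
  have hexl : Exact iₗ fₗ := hex
  have hfₗ : Surjective fₗ := hπ
  have hiₗ : Injective iₗ := hι
  let mS : S →ₗ[ℤ] S := LinearMap.lsmul ℤ S p
  let mU : U →ₗ[ℤ] U := LinearMap.lsmul ℤ U p
  let mP : P →ₗ[ℤ] P := LinearMap.lsmul ℤ P p
  have h₁ : iₗ.comp mS = mU.comp iₗ := LinearMap.ext fun a ↦ by simp [iₗ, mS, mU]
  have h₂ : fₗ.comp mU = mP.comp fₗ := LinearMap.ext fun b ↦ by simp [fₗ, mU, mP]
  let ι₂ : U[(p : ℤ)] →ₗ[ℤ] U := (U[(p : ℤ)]).subtype.toIntLinearMap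
  let ι₃ : P[(p : ℤ)] →ₗ[ℤ] P := (P[(p : ℤ)]).subtype.toIntLinearMap
  have hι₂ : Exact ι₂ mU := exact_subtype_torsionBy_lsmul p
  have hι₃ : Exact ι₃ mP := exact_subtype_torsionBy_lsmul p
  let π₁ : S →ₗ[ℤ] ModN S p := (LinearMap.range mS).mkQ
  let π₂ : U →ₗ[ℤ] ModN U p := (LinearMap.range mU).mkQ
  have hπ₁ : Exact mS π₁ := LinearMap.exact_map_mkQ_range mS
  have hπ₂ : Exact mU π₂ := LinearMap.exact_map_mkQ_range mU
  let F : U[(p : ℤ)] →ₗ[ℤ] P[(p : ℤ)] := (torsionByMap π p).toIntLinearMap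
  have hF : fₗ.comp ι₂ = ι₃.comp F := LinearMap.ext fun _ ↦ rfl
  let G : ModN S p →ₗ[ℤ] ModN U p := modNMap ι p
  have hG : G.comp π₁ = π₂.comp iₗ := LinearMap.ext fun _ ↦ rfl
  let δ : P[(p : ℤ)] →ₗ[ℤ] ModN S p :=
    SnakeLemma.δ' mS mU mP iₗ fₗ hexl iₗ fₗ hexl h₁ h₂ ι₃ hι₃ π₁ hπ₁ hfₗ hiₗ
  have hδr : Exact (torsionByMap π p) δ.toAddMonoidHom :=
    SnakeLemma.exact_δ'_right mS mU mP iₗ fₗ hexl iₗ fₗ hexl h₁ h₂ ι₂ hι₂ ι₃ hι₃ π₁ hπ₁ hfₗ hiₗ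
      F hF Subtype.val_injective
  have hδl : Exact δ.toAddMonoidHom (modNMap ι p).toAddMonoidHom :=
    SnakeLemma.exact_δ'_left mS mU mP iₗ fₗ hexl iₗ fₗ hexl h₁ h₂ ι₃ hι₃ π₁ hπ₁ π₂ hπ₂ hfₗ hiₗ
      G hG (Submodule.mkQ_surjective _)
  -- `U/pU → P/pP = 0`, so `S/pS → U/pU` is onto
  have hGsurj : Surjective (modNMap ι p).toAddMonoidHom := by
    intro q
    have hq : modNMap π p q = 0 := by
      obtain ⟨u, rfl⟩ := Submodule.mkQ_surjective _ q
      change modNMap π p (ModN.mkQ p u) = 0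
      rw [modNMap_mkQ, mkQ_eq_zero_iff]
      obtain ⟨y', hy'⟩ := hdiv (π u)
      exact ⟨y', by rw [← hy', natCast_zsmul]⟩
    have hmem : q ∈ LinearMap.ker (modNMap π p) := hq
    rw [ker_modNMap_eq_range (p := p) hπ (fun u hu ↦ by
      obtain ⟨s, hs⟩ := (hex u).mp hu; exact ⟨s, hs⟩) (fun s ↦ hex.apply_apply_eq_zero s)] at hmem
    obtain ⟨x, hx⟩ := hmem
    exact ⟨x, hx⟩
  -- count
  have c₁ : Nat.card (ModN S p) = Nat.card δ.toAddMonoidHom.range * Nat.card (modNMap ι p).toAddMonoidHom.range :=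
    natCard_eq_of_exact _ _ hδl
  have c₂ : Nat.card (modNMap ι p).toAddMonoidHom.range = Nat.card (ModN U p) :=
    natCard_range_of_surjective _ hGsurj
  have c₃ : Nat.card δ.toAddMonoidHom.range = Nat.card (P[(p : ℤ)] ⧸ (torsionByMap π p).range) := by
    rw [← hδr.addMonoidHom_ker_eq]
    exact (Nat.card_congr (QuotientAddGroup.quotientKerEquivRange δ.toAddMonoidHom).toEquiv).symm
  rw [c₁, c₂, c₃]

end Torsion

/-! ## §2 The index of the middle map of a morphism of three-term exact sequences -/

section Three

variable {Xω Xf X1 Yω Yf Y1 : Type*} [AddCommGroup Xω] [AddCommGroup Xf] [AddCommGroup X1]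
  [AddCommGroup Yω] [AddCommGroup Yf] [AddCommGroup Y1]

/-- Finiteness transport for the quotient rule: if `ℓ ∘ κ = κ' ∘ ρ` with `κ, κ'` onto, `κ'` with finite kernel, and `ρ`
has finite kernel and cokernel, then `ℓ` has finite kernel and cokernel. [folklore] -/
theorem finite_ker_coker_of_surjective {X Y X' Y' : Type*} [AddCommGroup X] [AddCommGroup Y] [AddCommGroup X']
    [AddCommGroup Y'] (ρ : X →+ Y) (ℓ : X' →+ Y') (κ : X →+ X') (κ' : Y →+ Y') (hκ : Surjective κ)
    (hκ' : Surjective κ') (hsq : ∀ x, ℓ (κ x) = κ' (ρ x)) [Finite κ'.ker] [Finite ρ.ker]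
    [Finite (Y ⧸ ρ.range)] :
    Finite ℓ.ker ∧ Finite (Y' ⧸ ℓ.range) := by
  constructor
  · -- `ker ℓ = κ(ρ⁻¹ ker κ')`, and `ρ⁻¹ ker κ'` is an extension of a subgroup of `ker κ'` by `ker ρ`
    let Z : AddSubgroup X := κ'.ker.comap ρ
    let φ : ρ.ker →+ Z := (ρ.ker.subtype).codRestrict Z fun x ↦ by
      change ρ (x : X) ∈ κ'.ker
      rw [(AddMonoidHom.mem_ker).1 x.2]; exact zero_mem _
    let ψ : Z →+ κ'.ker := (ρ.comp Z.subtype).codRestrict κ'.ker fun z ↦ z.2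
    have hφψ : Exact φ ψ := by
      intro z
      constructor
      · intro hz
        have hz' : ρ (z : X) = 0 := congrArg Subtype.val hz
        exact ⟨⟨(z : X), hz'⟩, Subtype.ext rfl⟩
      · rintro ⟨x, rfl⟩
        exact Subtype.ext ((AddMonoidHom.mem_ker).1 x.2)
    haveI : Finite Z := finite_of_exact φ ψ hφψ
    let θ : Z →+ ℓ.ker := (κ.comp Z.subtype).codRestrict ℓ.ker fun z ↦ by
      rw [AddMonoidHom.mem_ker, AddMonoidHom.comp_apply, hsq]
      exact z.2
    refine Finite.of_surjective θ fun x ↦ ?_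
    obtain ⟨y, hy⟩ := hκ (x : X')
    have hyZ : y ∈ Z := by
      change ρ y ∈ κ'.ker
      rw [AddMonoidHom.mem_ker, ← hsq, hy]
      exact (AddMonoidHom.mem_ker).1 x.2
    exact ⟨⟨y, hyZ⟩, Subtype.ext hy⟩
  · let G : Y ⧸ ρ.range →+ Y' ⧸ ℓ.range := QuotientAddGroup.map ρ.range ℓ.range κ' (by
      rintro _ ⟨x, rfl⟩
      exact ⟨κ x, hsq x⟩)
    refine Finite.of_surjective G fun q ↦ ?_
    obtain ⟨y', rfl⟩ := QuotientAddGroup.mk'_surjective ℓ.range q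
    obtain ⟨y, rfl⟩ := hκ' y'
    exact ⟨QuotientAddGroup.mk' ρ.range y, rfl⟩

/-- `#ker(X ↠ X/N) = #N`. [folklore] -/
theorem natCard_ker_mk' {X : Type*} [AddCommGroup X] (N : AddSubgroup X) :
    Nat.card (QuotientAddGroup.mk' N).ker = Nat.card N :=
  congrArg (fun H : AddSubgroup X ↦ Nat.card H) (QuotientAddGroup.ker_mk' N)

/-- `N ↪ X ↠ X/N` is exact. [folklore] -/
theorem exact_subtype_mk' {X : Type*} [AddCommGroup X] (N : AddSubgroup X) :
    Exact N.subtype (QuotientAddGroup.mk' N) := fun x ↦ by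
  rw [QuotientAddGroup.mk'_apply, QuotientAddGroup.eq_zero_iff]
  exact ⟨fun hx ↦ ⟨⟨x, hx⟩, rfl⟩, by rintro ⟨y, rfl⟩; exact y.2⟩

/-- **Restriction rule.** For `ρ : X → Y` with finite kernel and cokernel and a subgroup `B ≤ X` of finite index,
the restriction `ρ|_B` has finite kernel and cokernel and `#ker ρ|_B · #(X/B) · #coker ρ = #ker ρ · #coker ρ|_B`, i.e.
`ind ρ|_B = ind ρ − d(X/B)` (six-term count for the rows `0 → B → X → X/B → 0`, `0 → Y → Y → 0 → 0`).
[cite: MilneADT2006, I §2 (Herbrand quotients)] -/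
theorem natCard_ker_restrict_mul {X Y : Type*} [AddCommGroup X] [AddCommGroup Y] (ρ : X →+ Y) (B : AddSubgroup X)
    [Finite (X ⧸ B)] [Finite ρ.ker] [Finite (Y ⧸ ρ.range)] :
    Finite (ρ.comp B.subtype).ker ∧ Finite (Y ⧸ (ρ.comp B.subtype).range) ∧
      Nat.card (ρ.comp B.subtype).ker * Nat.card (X ⧸ B) * Nat.card (Y ⧸ ρ.range) =
        Nat.card ρ.ker * Nat.card (Y ⧸ (ρ.comp B.subtype).range) := by
  classical
  set T := ρ.comp B.subtype with hT
  -- induced maps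
  let F₁ : T.ker →+ ρ.ker := (B.subtype.comp T.ker.subtype).codRestrict ρ.ker fun k ↦ by
    rw [AddMonoidHom.mem_ker]
    exact (AddMonoidHom.mem_ker).1 k.2
  let F₂ : ρ.ker →+ X ⧸ B := (QuotientAddGroup.mk' B).comp ρ.ker.subtype
  have hle : T.range ≤ ρ.range.comap (AddMonoidHom.id Y) := by
    rintro _ ⟨x, rfl⟩
    exact ⟨(x : X), rfl⟩
  let G₁ : Y ⧸ T.range →+ Y ⧸ ρ.range := QuotientAddGroup.map T.range ρ.range (AddMonoidHom.id Y) hle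
  let G₂ : Y ⧸ ρ.range →+ PUnit.{1} := 0
  -- finiteness of the new corners
  have hF₁inj : Injective F₁ :=
    injective_kerMap (f₁ := B.subtype) (ι₁ := T.ker.subtype) (ι₂ := ρ.ker.subtype) Subtype.val_injective
      Subtype.val_injective fun _ ↦ rfl
  haveI : Finite T.ker := Finite.of_injective F₁ hF₁inj
  -- `X/B → Y/T.range → Y/ρ.range` exact in the middle
  let φ : X ⧸ B →+ Y ⧸ T.range := QuotientAddGroup.map B T.range ρ (by
    intro x hx
    exact ⟨⟨x, hx⟩, rfl⟩)
  have hφG : Exact φ G₁ := by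
    intro q
    constructor
    · intro hq
      obtain ⟨y, rfl⟩ := QuotientAddGroup.mk'_surjective T.range q
      have hy : y ∈ ρ.range := by
        have : (QuotientAddGroup.mk' ρ.range) y = 0 := hq
        rwa [QuotientAddGroup.mk'_apply, QuotientAddGroup.eq_zero_iff] at this
      obtain ⟨x, rfl⟩ := hy
      exact ⟨QuotientAddGroup.mk' B x, rfl⟩
    · rintro ⟨q', rfl⟩
      obtain ⟨x, rfl⟩ := QuotientAddGroup.mk'_surjective B q'
      change (QuotientAddGroup.mk' ρ.range) (ρ x) = 0
      rw [QuotientAddGroup.mk'_apply, QuotientAddGroup.eq_zero_iff]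
      exact ⟨x, rfl⟩
  haveI : Finite (Y ⧸ T.range) := finite_of_exact φ G₁ hφG
  refine ⟨inferInstance, inferInstance, ?_⟩
  have hcount := natCard_snake (M₁ := B) (M₂ := X) (M₃ := X ⧸ B) (N₁ := Y) (N₂ := Y) (N₃ := PUnit.{1})
    (K₁ := T.ker) (K₂ := ρ.ker) (K₃ := X ⧸ B) (C₁ := Y ⧸ T.range) (C₂ := Y ⧸ ρ.range) (C₃ := PUnit.{1})
    (f₁ := B.subtype) (f₂ := QuotientAddGroup.mk' B) (g₁ := AddMonoidHom.id Y) (g₂ := (0 : Y →+ PUnit.{1}))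
    (i₁ := T) (i₂ := ρ) (i₃ := (0 : X ⧸ B →+ PUnit.{1})) (ι₁ := T.ker.subtype) (ι₂ := ρ.ker.subtype)
    (ι₃ := AddMonoidHom.id (X ⧸ B)) (π₁ := QuotientAddGroup.mk' T.range) (π₂ := QuotientAddGroup.mk' ρ.range)
    (π₃ := AddMonoidHom.id PUnit.{1}) (F₁ := F₁) (F₂ := F₂) (G₁ := G₁) (G₂ := G₂)
    (exact_subtype_mk' B) (fun y ↦ ⟨fun _ ↦ ⟨y, rfl⟩, fun _ ↦ rfl⟩) Subtype.val_injective
    (QuotientAddGroup.mk'_surjective B) injective_id (fun u ↦ ⟨0, Subsingleton.elim _ _⟩)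
    (fun _ ↦ rfl) (fun _ ↦ rfl) (exact_ker_subtype T) (exact_ker_subtype ρ)
    (fun q ↦ ⟨fun _ ↦ ⟨q, rfl⟩, fun _ ↦ rfl⟩) Subtype.val_injective Subtype.val_injective injective_id
    (exact_mk'_range T) (exact_mk'_range ρ) (fun u ↦ ⟨fun _ ↦ ⟨0, Subsingleton.elim _ _⟩, fun _ ↦ rfl⟩)
    (QuotientAddGroup.mk'_surjective _) (QuotientAddGroup.mk'_surjective _) surjective_id
    (fun _ ↦ rfl) (fun _ ↦ rfl) (fun _ ↦ rfl) (fun _ ↦ rfl)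
  rw [Nat.card_unique (α := PUnit.{1}), mul_one] at hcount
  exact hcount

/-- **The index of the middle map of a morphism of three-term exact sequences.** For a commutative diagram of
abelian groups with rows `X_ω →a X_f →b X_1` (exact at `X_f`, `ker a` finite, `coker b` finite) and
`Y_ω →a' Y_f →b' Y_1` (exact at `Y_f`, `ker a'` finite, `b'` onto) and verticals `ρ_ω, ρ_f, ρ_1` with finite kernels
and cokernels:
`#ker ρ_f · #coker ρ_ω · #coker ρ_1 · #ker a · #coker b = #ker ρ_ω · #ker ρ_1 · #coker ρ_f · #ker a'`,
i.e. `ind ρ_f = ind ρ_ω + ind ρ_1 − d ker a + d ker a' − d coker b`. Used with `X_? = H¹(G, N_?)`,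
`Y_? = ⊕_{w∣v̄} H¹(G_w, N_?)` along `0 → N_ω → N_f → N_1 → 0`, `ρ_?` the localisations (V21 road step (3)).
[cite: MilneADT2006, I §2 (Herbrand quotients)] [cite: KellerYin2024, §1.4 (arXiv:2402.12781v2 TeX L1183–1330)] -/
theorem natCard_index_three (a : Xω →+ Xf) (b : Xf →+ X1) (a' : Yω →+ Yf) (b' : Yf →+ Y1)
    (ρω : Xω →+ Yω) (ρf : Xf →+ Yf) (ρ1 : X1 →+ Y1)
    (hab : Exact a b) (hab' : Exact a' b') (hb' : Surjective b')
    (sq₁ : ∀ x, ρf (a x) = a' (ρω x)) (sq₂ : ∀ x, ρ1 (b x) = b' (ρf x))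
    [Finite a.ker] [Finite a'.ker] [Finite (X1 ⧸ b.range)]
    [Finite ρω.ker] [Finite ρf.ker] [Finite ρ1.ker]
    [Finite (Yω ⧸ ρω.range)] [Finite (Yf ⧸ ρf.range)] [Finite (Y1 ⧸ ρ1.range)] :
    Nat.card ρf.ker * Nat.card (Yω ⧸ ρω.range) * Nat.card (Y1 ⧸ ρ1.range) * Nat.card a.ker *
        Nat.card (X1 ⧸ b.range) =
      Nat.card ρω.ker * Nat.card ρ1.ker * Nat.card (Yf ⧸ ρf.range) * Nat.card a'.ker := by
  classical
  /- Step A: the quotient rule for `T₁ : Xω/ker a → Yω/ker a'`. -/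
  have hle : a.ker ≤ a'.ker.comap ρω := fun x hx ↦ by
    rw [AddSubgroup.mem_comap, AddMonoidHom.mem_ker, ← sq₁, (AddMonoidHom.mem_ker).1 hx, map_zero]
  let T₁ : Xω ⧸ a.ker →+ Yω ⧸ a'.ker := QuotientAddGroup.map a.ker a'.ker ρω hle
  have hsqA : ∀ x, T₁ (QuotientAddGroup.mk' a.ker x) = QuotientAddGroup.mk' a'.ker (ρω x) := fun _ ↦ rfl
  haveI : Finite (QuotientAddGroup.mk' a.ker).ker := by rw [QuotientAddGroup.ker_mk']; infer_instance
  haveI : Finite (QuotientAddGroup.mk' a'.ker).ker := by rw [QuotientAddGroup.ker_mk']; infer_instance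
  obtain ⟨hKT₁, hCT₁⟩ := finite_ker_coker_of_surjective ρω T₁ (QuotientAddGroup.mk' a.ker)
    (QuotientAddGroup.mk' a'.ker) (QuotientAddGroup.mk'_surjective _) (QuotientAddGroup.mk'_surjective _) hsqA
  haveI := hKT₁
  haveI := hCT₁
  have hA := natCard_ker_mul_of_surjective ρω T₁ (QuotientAddGroup.mk' a.ker) (QuotientAddGroup.mk' a'.ker)
    (QuotientAddGroup.mk'_surjective _) (QuotientAddGroup.mk'_surjective _) hsqA
  rw [natCard_ker_mk', natCard_ker_mk'] at hA
  /- Step B: the restriction rule for `T₃ = ρ1|_{im b}`. -/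
  obtain ⟨hKT₃, hCT₃, hB⟩ := natCard_ker_restrict_mul ρ1 b.range
  haveI := hKT₃
  haveI := hCT₃
  set T₃ := ρ1.comp b.range.subtype with hT₃
  /- Step C: the six-term count for `(T₁, ρf, T₃)` on `0 → Xω/ker a → Xf → im b → 0` over `0 → Yω/ker a' → Yf → Y1 → 0`. -/
  let abar : Xω ⧸ a.ker →+ Xf := QuotientAddGroup.kerLift a
  let abar' : Yω ⧸ a'.ker →+ Yf := QuotientAddGroup.kerLift a'
  let bbar : Xf →+ b.range := b.rangeRestrict
  have habar : Exact abar bbar := by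
    intro x
    rw [show bbar x = 0 ↔ b x = 0 from ⟨fun h ↦ congrArg Subtype.val h, fun h ↦ Subtype.ext h⟩, hab x]
    constructor
    · rintro ⟨y, rfl⟩
      exact ⟨QuotientAddGroup.mk' a.ker y, rfl⟩
    · rintro ⟨q, rfl⟩
      obtain ⟨y, rfl⟩ := QuotientAddGroup.mk'_surjective a.ker q
      exact ⟨y, rfl⟩
  have habar' : Exact abar' b' := by
    intro y
    rw [hab' y]
    constructor
    · rintro ⟨z, rfl⟩
      exact ⟨QuotientAddGroup.mk' a'.ker z, rfl⟩
    · rintro ⟨q, rfl⟩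
      obtain ⟨z, rfl⟩ := QuotientAddGroup.mk'_surjective a'.ker q
      exact ⟨z, rfl⟩
  have h₁ : ∀ q, abar' (T₁ q) = ρf (abar q) := by
    intro q
    obtain ⟨x, rfl⟩ := QuotientAddGroup.mk'_surjective a.ker q
    exact (sq₁ x).symm
  have h₂ : ∀ x, b' (ρf x) = T₃ (bbar x) := fun x ↦ (sq₂ x).symm
  let F₁ : T₁.ker →+ ρf.ker := (abar.comp T₁.ker.subtype).codRestrict ρf.ker fun k ↦ by
    rw [AddMonoidHom.mem_ker, AddMonoidHom.comp_apply, ← h₁]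
    change abar' (T₁ k) = 0
    rw [(AddMonoidHom.mem_ker).1 k.2, map_zero]
  let F₂ : ρf.ker →+ T₃.ker := (bbar.comp ρf.ker.subtype).codRestrict T₃.ker fun k ↦ by
    rw [AddMonoidHom.mem_ker]
    change T₃ (bbar k) = 0
    rw [← h₂, (AddMonoidHom.mem_ker).1 k.2, map_zero]
  let G₁ : (Yω ⧸ a'.ker) ⧸ T₁.range →+ Yf ⧸ ρf.range := QuotientAddGroup.map T₁.range ρf.range abar' (by
    rintro _ ⟨q, rfl⟩
    exact ⟨abar q, (h₁ q).symm⟩)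
  let G₂ : Yf ⧸ ρf.range →+ Y1 ⧸ T₃.range := QuotientAddGroup.map ρf.range T₃.range b' (by
    rintro _ ⟨x, rfl⟩
    exact ⟨bbar x, (h₂ x).symm⟩)
  have hC := natCard_snake (K₁ := T₁.ker) (K₂ := ρf.ker) (K₃ := T₃.ker) (C₁ := (Yω ⧸ a'.ker) ⧸ T₁.range)
    (C₂ := Yf ⧸ ρf.range) (C₃ := Y1 ⧸ T₃.range) (f₁ := abar) (f₂ := bbar) (g₁ := abar') (g₂ := b')
    (i₁ := T₁) (i₂ := ρf) (i₃ := T₃) (ι₁ := T₁.ker.subtype) (ι₂ := ρf.ker.subtype) (ι₃ := T₃.ker.subtype)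
    (π₁ := QuotientAddGroup.mk' T₁.range) (π₂ := QuotientAddGroup.mk' ρf.range)
    (π₃ := QuotientAddGroup.mk' T₃.range) (F₁ := F₁) (F₂ := F₂) (G₁ := G₁) (G₂ := G₂) habar habar'
    (QuotientAddGroup.kerLift_injective a) b.rangeRestrict_surjective (QuotientAddGroup.kerLift_injective a') hb'
    h₁ h₂ (exact_ker_subtype T₁) (exact_ker_subtype ρf) (exact_ker_subtype T₃) Subtype.val_injective
    Subtype.val_injective Subtype.val_injective (exact_mk'_range T₁) (exact_mk'_range ρf) (exact_mk'_range T₃)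
    (QuotientAddGroup.mk'_surjective _) (QuotientAddGroup.mk'_surjective _) (QuotientAddGroup.mk'_surjective _)
    (fun _ ↦ rfl) (fun _ ↦ rfl) (fun _ ↦ rfl) (fun _ ↦ rfl)
  /- Step D: combine. -/
  have hpos : 0 < Nat.card ((Yω ⧸ a'.ker) ⧸ T₁.range) * Nat.card (Y1 ⧸ T₃.range) :=
    Nat.mul_pos Nat.card_pos Nat.card_pos
  refine Nat.eq_of_mul_eq_mul_right hpos ?_
  calc Nat.card ρf.ker * Nat.card (Yω ⧸ ρω.range) * Nat.card (Y1 ⧸ ρ1.range) * Nat.card a.ker *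
          Nat.card (X1 ⧸ b.range) * (Nat.card ((Yω ⧸ a'.ker) ⧸ T₁.range) * Nat.card (Y1 ⧸ T₃.range))
      = (Nat.card ρf.ker * Nat.card ((Yω ⧸ a'.ker) ⧸ T₁.range) * Nat.card (Y1 ⧸ T₃.range)) *
          (Nat.card (Yω ⧸ ρω.range) * Nat.card (Y1 ⧸ ρ1.range) * Nat.card a.ker * Nat.card (X1 ⧸ b.range)) := by
        ring
    _ = (Nat.card T₁.ker * Nat.card T₃.ker * Nat.card (Yf ⧸ ρf.range)) *
          (Nat.card (Yω ⧸ ρω.range) * Nat.card (Y1 ⧸ ρ1.range) * Nat.card a.ker * Nat.card (X1 ⧸ b.range)) := by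
        rw [hC]
    _ = Nat.card (Yf ⧸ ρf.range) * (Nat.card T₁.ker * Nat.card (Yω ⧸ ρω.range) * Nat.card a.ker) *
          (Nat.card T₃.ker * Nat.card (X1 ⧸ b.range) * Nat.card (Y1 ⧸ ρ1.range)) := by ring
    _ = Nat.card (Yf ⧸ ρf.range) * (Nat.card ρω.ker * Nat.card ((Yω ⧸ a'.ker) ⧸ T₁.range) * Nat.card a'.ker) *
          (Nat.card ρ1.ker * Nat.card (Y1 ⧸ T₃.range)) := by rw [← hA, hB]
    _ = Nat.card ρω.ker * Nat.card ρ1.ker * Nat.card (Yf ⧸ ρf.range) * Nat.card a'.ker *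
          (Nat.card ((Yω ⧸ a'.ker) ⧸ T₁.range) * Nat.card (Y1 ⧸ T₃.range)) := by ring

end Three

end Summit.BirchSwinnertonDyer.BirchSwinnertonDyer.Theorems.FiniteIndexCalculus

end
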